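import Summits.MatrixMultiplication.MatrixMultiplication.Theorems.SoloInformedTwistedMatchingsPrimePowerHost
import HarnessLib

/-!
# Theorem B″ for translation schemes, literally (Cohn–Umans 2013, Def. 11/12)

Solo-informed seat (MatrixMultiplication), gen 101; sharpest-statement §2y(8) — the scheme-level
dictionary. The TRANSLATION SCHEME `𝒮(S, M₀)` of a finite abelian group `S` and `M₀ ≤ Aut S` has point
set `S` and classes `R_i = {(x,y) : c(y x⁻¹) = i}`, where `c : S → C` labels the `M₀`-orbits
(`c g = c h ⟺ ∃ φ ∈ M₀, φ g = h`); its rank is the number of orbits `≥ |S|/|M₀|`. Classes `i, j, k` form a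
TRIANGLE (CU13 Def. 11) iff there are points `x, y, z` with `(x,y) ∈ R_i`, `(y,z) ∈ R_j`, `(z,x) ∈ R_k`,
i.e. iff `∃ g h l ∈ S` with labels `i, j, k` and `g·h·l = 1` (put `g = yx⁻¹`, `h = zy⁻¹`, `l = xz⁻¹`;
conversely `x = 1`, `y = g`, `z = gh`). A REALIZATION of `⟨n,n,n⟩` (CU13 Def. 12) is a triple of maps
`A, B, Γ : [n]² → C` with "`A(x), B(y), Γ(z)` form a triangle ⟺ `y₁ = x₂ ∧ z₁ = y₂ ∧ z₂ = x₁`"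
(injectivity of `A, B, Γ`, required in Def. 12, is not needed below).

`translationScheme_realization_card_ge_behrend`: for every `m ≥ 1` there is `δ(m) > 0` such that if
`𝒮(S, M₀)`, `S` abelian with `g^m = 1`, `M₀ ≤ Aut S` arbitrary, realizes `⟨3N,3N,3N⟩`, then
`N² e^{-4√(log N)} ≤ 3|S|^{1-δ(m)}`. (Orbit representatives turn the triangle predicate into the twisted
predicate `∃ (φ,ψ) ∈ M₀², α(x)·φ(β(y))·ψ(γ(z)) = 1` of `realization_exp_card_ge_behrend`.) With
rank `≥ |S|/|M₀|`: Conj. 21's requirement rank `≤ n^{2+o(1)}` along translation schemes over hosts of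
exponent dividing `m` forces `|M₀| ≥ |S|^{δ(m)-o(1)}`.
References: CohnUmans2013 (arXiv:1207.6528) Def. 11, Def. 12, §5, Conj. 21;
BCCGNSU17 (arXiv:1605.06702) p. 4 (schemes not covered there).
-/

noncomputable section

open scoped BigOperators
open Finset

namespace Summit.MatrixMultiplication.MatrixMultiplication.Theorems.TwistedSliceRank

section TranslationSchemes

/-- **Triangles of a translation scheme = the twisted triangle predicate.** If `c : S → C` labels the
orbits of `M₀ ≤ Aut S` (`S` abelian) and `α x, β y, γ z` represent the classes `A x, B y, Γ z`, then
"`A x, B y, Γ z` form a triangle" `⟺ ∃ (φ, ψ) ∈ M₀², α x · φ(β y) · ψ(γ z) = 1`. [CU13 Def. 11, unfolded] -/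
theorem triangle_iff_twisted {S : Type*} [CommGroup S] (M₀ : Subgroup (MulAut S)) {C : Type*}
    (c : S → C) (hc : ∀ g h : S, c g = c h ↔ ∃ φ : M₀, (φ : MulAut S) g = h)
    {a b d : S} {i j k : C} (ha : c a = i) (hb : c b = j) (hd : c d = k) :
    (∃ g h l : S, c g = i ∧ c h = j ∧ c l = k ∧ g * h * l = 1) ↔
      ∃ s : M₀ × M₀, a * (s.1 : MulAut S) b * (s.2 : MulAut S) d = 1 := by
  constructor
  · rintro ⟨g, h, l, hg, hh, hl, hghl⟩
    obtain ⟨φ₁, h1⟩ := (hc g a).1 (hg.trans ha.symm)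
    obtain ⟨φ₂, h2⟩ := (hc h b).1 (hh.trans hb.symm)
    obtain ⟨φ₃, h3⟩ := (hc l d).1 (hl.trans hd.symm)
    refine ⟨(φ₁ * φ₂⁻¹, φ₁ * φ₃⁻¹), ?_⟩
    have h2' : ((φ₂ : MulAut S)⁻¹) b = h := by
      rw [MulAut.inv_def, MulEquiv.symm_apply_eq]; exact h2.symm
    have h3' : ((φ₃ : MulAut S)⁻¹) d = l := by
      rw [MulAut.inv_def, MulEquiv.symm_apply_eq]; exact h3.symm
    simp only [Subgroup.coe_mul, Subgroup.coe_inv, MulAut.mul_apply, h2', h3', ← h1, ← map_mul, hghl,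
      map_one]
  · rintro ⟨s, hs⟩
    refine ⟨a, (s.1 : MulAut S) b, (s.2 : MulAut S) d, ha, ?_, ?_, hs⟩
    · rw [← hb]; exact ((hc b _).2 ⟨s.1, rfl⟩).symm
    · rw [← hd]; exact ((hc d _).2 ⟨s.2, rfl⟩).symm

/-- **Theorem B″ for translation schemes (Cohn–Umans Def. 12, literally).** For every `m ≥ 1` there is
`δ > 0` such that: if `S` is a finite abelian group with `g^m = 1`, `M₀ ≤ Aut S` is ANY subgroup,
`c : S → C` labels the `M₀`-orbits, and `A, B, Γ : [3N]² → C` satisfy "`A x, B y, Γ z` form a triangle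
of `𝒮(S, M₀)` ⟺ `(x, y, z)` is a matrix-multiplication triple", then `N² e^{-4√(log N)} ≤ 3|S|^{1-δ}`.
[this work] -/
theorem translationScheme_realization_card_ge_behrend (m : ℕ) (hm : 0 < m) :
    ∃ δ : ℝ, 0 < δ ∧ ∀ (S : Type) [CommGroup S] [Fintype S] [DecidableEq S],
      (∀ g : S, g ^ m = 1) →
      ∀ (M₀ : Subgroup (MulAut S)) (C : Type) (c : S → C),
      (∀ g h : S, c g = c h ↔ ∃ φ : M₀, (φ : MulAut S) g = h) →
      ∀ (N : ℕ) (A B Γ : Fin (3 * N) × Fin (3 * N) → C),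
      (∀ x y z : Fin (3 * N) × Fin (3 * N),
          (∃ g h l : S, c g = A x ∧ c h = B y ∧ c l = Γ z ∧ g * h * l = 1) ↔
          (y.1 = x.2 ∧ z = (y.2, x.1))) →
      ((N : ℝ) ^ 2 * Real.exp (-4 * Real.sqrt (Real.log N))) ≤
        3 * (Fintype.card S : ℝ) ^ (1 - δ) := by
  obtain ⟨δ, hδ0, hmain⟩ := realization_exp_card_ge_behrend m hm
  refine ⟨δ, hδ0, fun S _ _ _ hexpS M₀ C c hc N A B Γ hreal => ?_⟩
  rcases Nat.eq_zero_or_pos N with hN | hN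
  · subst hN
    simp only [Nat.cast_zero, ne_eq, OfNat.ofNat_ne_zero, not_false_eq_true, zero_pow, zero_mul]
    positivity
  -- finiteness of the twist family `M₀ × M₀`
  haveI : Finite (MulAut S) :=
    Finite.of_injective (fun e : MulAut S => (e : S → S)) DFunLike.coe_injective
  haveI : Fintype (↥M₀ × ↥M₀) := Fintype.ofFinite _
  -- orbit representatives of the classes used
  have w : Fin (3 * N) := ⟨0, by omega⟩
  have hA : ∀ x, ∃ g : S, c g = A x := fun x => by
    obtain ⟨g, h, l, hg, -, -, -⟩ := (hreal x (x.2, w) (w, x.1)).2 ⟨rfl, rfl⟩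
    exact ⟨g, hg⟩
  have hB : ∀ y, ∃ g : S, c g = B y := fun y => by
    obtain ⟨g, h, l, -, hh, -, -⟩ := (hreal (w, y.1) y (y.2, w)).2 ⟨rfl, rfl⟩
    exact ⟨h, hh⟩
  have hΓ : ∀ z, ∃ g : S, c g = Γ z := fun z => by
    obtain ⟨g, h, l, -, -, hl, -⟩ := (hreal (z.2, w) (w, z.1) z).2 ⟨rfl, Prod.ext rfl rfl⟩
    exact ⟨l, hl⟩
  choose α hα using hA
  choose β hβ using hB
  choose γ hγ using hΓ
  refine hmain S hexpS (↥M₀ × ↥M₀) (fun s => (s.1 : MulAut S)) (fun s => (s.2 : MulAut S)) N α β γ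
    fun x y z => ?_
  rw [← hreal x y z]
  exact (triangle_iff_twisted M₀ c hc (hα x) (hβ y) (hγ z)).symm

/-- **The rank side**: the number of `M₀`-orbit labels actually used is at least `|S|/|M₀|`, i.e.
`|S| ≤ (#labels)·|M₀|` — the rank of `𝒮(S, M₀)` is `≥ |S|/|M₀|`. [CU13 §5, orbit counting] -/
theorem card_le_card_labels_mul {S : Type*} [Group S] [Fintype S] (M₀ : Subgroup (MulAut S))
    [Fintype M₀] {C : Type*} [Fintype C] [DecidableEq C] (c : S → C)
    (hc : ∀ g h : S, c g = c h ↔ ∃ φ : M₀, (φ : MulAut S) g = h) :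
    Fintype.card S ≤ Fintype.card C * Fintype.card M₀ := by
  classical
  -- `g ↦ (c g, the φ with φ g₀ = g)` where `g₀` represents the orbit: inject `S` into `C × M₀` fibrewise
  have hrep : ∀ i : Set.range c, ∃ g : S, c g = i := fun i => i.2
  choose ρ hρ using hrep
  have hφ : ∀ g : S, ∃ φ : M₀, (φ : MulAut S) (ρ ⟨c g, g, rfl⟩) = g := fun g =>
    (hc _ g).1 (hρ ⟨c g, g, rfl⟩)
  choose Φ hΦ using hφ
  let f : S → C × M₀ := fun g => (c g, Φ g)
  have hf : Function.Injective f := by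
    intro g h hgh
    simp only [f, Prod.mk.injEq] at hgh
    obtain ⟨h1, h2⟩ := hgh
    have e1 := hΦ g
    have e2 := hΦ h
    have h3 : (⟨c g, g, rfl⟩ : Set.range c) = ⟨c h, h, rfl⟩ := Subtype.ext h1
    rw [h3, h2] at e1
    exact e1.symm.trans e2
  calc Fintype.card S ≤ Fintype.card (C × ↥M₀) := Fintype.card_le_of_injective f hf
    _ = Fintype.card C * Fintype.card M₀ := Fintype.card_prod _ _

end TranslationSchemes

end Summit.MatrixMultiplication.MatrixMultiplication.Theorems.TwistedSliceRank
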